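import Literature.NumberTheory.EllipticCurves.IsogenyComplexUniformizationProofs
import Literature.NumberTheory.EllipticCurves.IsogenyRealPeriodProofs
import Literature.NumberTheory.EllipticCurves.LatticeInclusionIsogenyDegreeProofs
import Literature.NumberTheory.EllipticCurves.ModularCurveNeronLatticeProofs
import Literature.NumberTheory.EllipticCurves.ComplexTorusAddProofs
import HarnessLib

/-!
# The analytic scalar of a `ℚ`-isogeny inside an isogeny class with `E[3]` irreducible has
# `3`-free index (proof of `isogenyScalar_threeFree_of_irreducible`)

Topic `NumberTheory/EllipticCurves`; a proofs-only file (theorems only: no definition, no named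
fact, no instance, no `sorry`; D-0014 sibling of `IsogenyAnalyticScalarThreeFree.lean`, whose
named fact `isogenyScalar_threeFree_of_irreducible` (bsd-stepL, crux stmt-BirchSwinnertonDyer-24801,
the (ISOG) conjunct of the cite stub of `Lines/lattice.lean`) it discharges:
`isogenyScalar_threeFree_of_irreducible_holds` is the one-line application of
`exists_isogenyScalar_threeFree_of_irreducible` below, appended to that file).

STATEMENT PROVED (`exists_isogenyScalar_threeFree_of_irreducible`): for elliptic `V, W₁, W₂ / ℚ`
with `V ~ W₁`, `V ~ W₂` (`ℚ`-isogenous), `V[3]` irreducible, and period pairs `L₁, L₂` of Néron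
type for `W₁, W₂` (`IsNeronLatticeOf`), there are `α ∈ ℂ` and `d ∈ ℕ` with `3 ∤ d`,
`αΛ₂ ⊆ Λ₁` and `dΛ₁ ⊆ αΛ₂`.

PROOF (Silverman, *AEC*, VI.4.1 (b), III.4.12, III.6.2; everything below is assembled from tree
theorems). The key step is `exists_rat_mul_mem_lattice_threeFree_of_irreducible`: for a
`ℚ`-isogeny `ψ : V → W`, Néron-type period pairs `L_V, L` and `V[3]` irreducible there is
`c ∈ ℚˣ` with `cΛ_V ⊆ Λ` and `[Λ : cΛ_V]` prime to `3`.
* The analytic multiplier of `ψ` on the uniformisations of the given models is a non-zero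
  RATIONAL `k` with `kΛ_V ⊆ Λ` (`Isogeny.exists_mul_baseChange_apply_eq`, *AEC* VI.4.1 (b), and
  `Isogeny.exists_algebraMap_eq_of_baseChange_apply_eq`, Galois descent of `ψ^*ω'/ω`).
* Strong induction on the index `N = [Λ : cΛ_V]` of a rational inclusion `cΛ_V ⊆ Λ` (finite and
  non-zero, `PeriodPair.relIndex_mulLeft_ne_zero`). If `3 ∤ N`, take `d = N` (`NΛ ⊆ cΛ_V`).
  If `3 ∣ N`: the inclusion is the analytic form of a `ℚ`-isogeny `φ_c : V → W`, `z ↦ cz` on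
  algebraic points, of degree `N` (`exists_isogeny_apply_eq_degree_eq_of_forall_mul_mem_lattice`);
  by Cauchy its kernel contains a point of order `3`, so the `Γ_ℚ`-stable subgroup
  `H = ker φ_c ∩ V[3]` of `V[3]` is non-zero, hence ALL of `V[3]` (irreducibility); since every
  `3`-torsion point of `V(ℂ)` is algebraic (`#V(ℚ̄)[3] = #V(ℂ)[3] = 9`,
  `WeierstrassCurve.card_torsionBy_eq_sq`), `φ_c` kills `u_V(λ/3)` for every `λ ∈ Λ_V`, i.e.
  `cΛ_V ⊆ 3Λ`; so `c/3` still gives an inclusion, of index `< N` because `(c/3)Λ_V ⊋ cΛ_V`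
  (`ω₁/3 ∉ Λ_V`, Mathlib `PeriodPair.mul_ω₁_add_mul_ω₂_mem_lattice`), and the induction
  hypothesis applies. (This is the printed argument «a cyclic `ℚ`-isogeny of degree divisible by `3`
  out of `V` yields a rational subgroup of order `3`», run on the lattice side so that no quotient
  isogeny has to be constructed.)
* Assembly: with `(c₁, d₁)` for `(V, W₁)` and `(c₂, d₂)` for `(V, W₂)` (a Néron-type pair `L_V`
  of `V` exists, `exists_isNeronLatticeOf_holds`), `α = c₁d₂/c₂` and `d = d₁d₂` work:
  `αΛ₂ = (c₁/c₂)(d₂Λ₂) ⊆ (c₁/c₂)(c₂Λ_V) = c₁Λ_V ⊆ Λ₁` and `d₁d₂Λ₁ ⊆ d₂c₁Λ_V = α(c₂Λ_V) ⊆ αΛ₂`.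

Filed by the BSD cell `bsd-stepL` (seat `defn-ty1` g42). Nothing is asserted about any particular
curve; BSD is proved for no curve.

## References

* J. H. Silverman, *The Arithmetic of Elliptic Curves*, 2nd ed., GTM 106 (2009), Thm. VI.4.1 (b),
  III.4.12, Cor. III.6.4 (b), Thm. III.6.2. [cite: SilvermanAEC2009, VI.4.1 (b), III.4.12 and III.6.2]
* J. E. Cremona, *Algorithms for Modular Elliptic Curves* (1997), §3.8. [cite: Cremona1997, §3.8]
-/

noncomputable section

open scoped Classical

namespace Literature.NumberTheory.EllipticCurves

open WeierstrassCurve PeriodPair Literature.NumberTheory.EllipticCurves.ModularForms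

/-! ### 1. Torsion points of `W(ℂ)` are algebraic -/

/-- **All torsion of `W(ℂ)` is algebraic**: for an elliptic curve `W/ℚ`, an embedding `j : ℚ̄ → ℂ`
and `n ≥ 1`, every `P ∈ W(ℂ)` with `nP = O` is `j_* m` for some `m ∈ W(ℚ̄)` (both `n`-torsion
groups have `n²` elements, `WeierstrassCurve.card_torsionBy_eq_sq`, and `j_*` is injective).
VERBATIM the auxiliary step `htors` of the tree's
`exists_isogeny_apply_eq_degree_eq_of_forall_mul_mem_lattice`. [cite: SilvermanAEC2009, Cor. III.6.4 (b)] -/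
theorem mem_range_map_of_nsmul_eq_zero {W : WeierstrassCurve ℚ} [W.IsElliptic]
    (j : (AlgebraicClosure ℚ) →ₐ[ℚ] ℂ) {n : ℕ} (hn : 0 < n) (P : (W.baseChange ℂ).toAffine.Point)
    (hP : n • P = 0) : P ∈ (Affine.Point.map (W' := W) j).range := by
  set jW : W.geomPoints →+ (W.baseChange ℂ).toAffine.Point := Affine.Point.map (W' := W) j with hjW
  have hj : Function.Injective jW := Affine.Point.map_injective (W' := W) j
  haveI : (W.baseChange (AlgebraicClosure ℚ)).IsElliptic := by
    rw [WeierstrassCurve.baseChange]; infer_instance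
  haveI : (W.baseChange ℂ).IsElliptic := by
    rw [WeierstrassCurve.baseChange]; infer_instance
  have h1 : Nat.card (AddSubgroup.torsionBy W.geomPoints (n : ℤ)) = n ^ 2 :=
    WeierstrassCurve.card_torsionBy_eq_sq (E := W.baseChange (AlgebraicClosure ℚ))
      (by exact_mod_cast hn.ne')
  have h2 : Nat.card (AddSubgroup.torsionBy (W.baseChange ℂ).toAffine.Point (n : ℤ)) = n ^ 2 :=
    WeierstrassCurve.card_torsionBy_eq_sq (E := W.baseChange ℂ) (by exact_mod_cast hn.ne')
  set T₁ : Set W.geomPoints :=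
    (AddSubgroup.torsionBy W.geomPoints (n : ℤ) : Set W.geomPoints) with hT₁
  set T₂ : Set (W.baseChange ℂ).toAffine.Point :=
    (AddSubgroup.torsionBy (W.baseChange ℂ).toAffine.Point (n : ℤ) :
      Set (W.baseChange ℂ).toAffine.Point) with hT₂
  have hsub : jW '' T₁ ⊆ T₂ := by
    rintro _ ⟨m, hm, rfl⟩
    have hm' : n • m = 0 := AddSubgroup.torsionBy.nsmul_iff.mp hm
    have hgoal : n • jW m = 0 := by rw [← map_nsmul, hm']; exact map_zero jW
    exact AddSubgroup.torsionBy.nsmul_iff.mpr hgoal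
  have hT₂fin : T₂.Finite := by
    have : Finite (AddSubgroup.torsionBy (W.baseChange ℂ).toAffine.Point (n : ℤ)) :=
      Nat.finite_of_card_ne_zero (by rw [h2]; exact pow_ne_zero 2 hn.ne')
    exact Set.toFinite _
  have hcard : T₂.ncard ≤ (jW '' T₁).ncard := by
    rw [Set.ncard_image_of_injective _ hj, ← Nat.card_coe_set_eq, ← Nat.card_coe_set_eq]
    exact (h2.trans h1.symm).le
  have heq : jW '' T₁ = T₂ := Set.eq_of_subset_of_ncard_le hsub hcard hT₂fin
  have hP' : P ∈ T₂ := AddSubgroup.torsionBy.nsmul_iff.mpr hP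
  rw [← heq] at hP'
  obtain ⟨m, -, hm⟩ := hP'
  exact ⟨m, hm⟩

/-! ### 2. A rational inclusion `cΛ_V ⊆ Λ` of index prime to `3` -/

/-- **The `3`-free rational lattice inclusion of an isogeny out of a curve with `E[3]` irreducible.**
For a `ℚ`-isogeny `ψ : V → W` of elliptic curves over `ℚ`, Néron-type period pairs `L_V`, `L` of
`V`, `W` and `V[3]` irreducible, there are `c ∈ ℚˣ` and `d ∈ ℕ` with `3 ∤ d`, `cΛ_V ⊆ Λ` and
`dΛ ⊆ cΛ_V` (the multiplier of `ψ` is rational; divide it by `3` as long as the `ℚ`-isogeny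
`z ↦ cz` has degree divisible by `3`, which by irreducibility of `V[3]` forces `cΛ_V ⊆ 3Λ`).
[cite: SilvermanAEC2009, VI.4.1 (b), III.4.12 and III.6.2] -/
theorem exists_rat_mul_mem_lattice_threeFree_of_irreducible {V W : WeierstrassCurve ℚ}
    [V.IsElliptic] [W.IsElliptic] (ψ : Isogeny V W) {LV L : PeriodPair}
    (hLV : IsNeronLatticeOf (V.baseChange ℂ) LV) (hL : IsNeronLatticeOf (W.baseChange ℂ) L)
    (hirr : V.HasIrreducibleModPGaloisRep 3) :
    ∃ c : ℚ, c ≠ 0 ∧ (∀ z ∈ LV.lattice, (c : ℂ) * z ∈ L.lattice) ∧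
      ∃ d : ℕ, ¬ 3 ∣ d ∧ ∀ y ∈ L.lattice, ∃ x ∈ LV.lattice, (d : ℂ) * y = c * x := by
  haveI : Algebra.IsAlgebraic ℚ (AlgebraicClosure ℚ) := AlgebraicClosure.isAlgebraic ℚ
  letI : Algebra (AlgebraicClosure ℚ) ℂ :=
    (IsAlgClosed.lift : AlgebraicClosure ℚ →ₐ[ℚ] ℂ).toRingHom.toAlgebra
  haveI : IsScalarTower ℚ (AlgebraicClosure ℚ) ℂ :=
    IsScalarTower.of_algebraMap_eq' (Subsingleton.elim _ _)
  set j : (AlgebraicClosure ℚ) →ₐ[ℚ] ℂ := IsScalarTower.toAlgHom ℚ (AlgebraicClosure ℚ) ℂ with hj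
  have hjinj : Function.Injective (Affine.Point.map (W' := V) j) :=
    Affine.Point.map_injective (W' := V) j
  -- uniformisations of the two given models
  obtain ⟨uV, hkerV, hsurjV, huV⟩ := LV.exists_addMonoidHom_of_g₂_g₃' hLV.1 hLV.2
  obtain ⟨u, hker, -, hu⟩ := L.exists_addMonoidHom_of_g₂_g₃' hL.1 hL.2
  have huV0 : ∀ z, uV z = 0 ↔ z ∈ LV.lattice := fun z ↦ by
    rw [← SetLike.mem_coe, ← hkerV, SetLike.mem_coe, AddMonoidHom.mem_ker]
  have hu0 : ∀ z, u z = 0 ↔ z ∈ L.lattice := fun z ↦ by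
    rw [← SetLike.mem_coe, ← hker, SetLike.mem_coe, AddMonoidHom.mem_ker]
  -- the analytic multiplier of `ψ` is a non-zero rational `k` with `kΛ_V ⊆ Λ`
  obtain ⟨α, hα0, hαΛ, happ, -⟩ :=
    ψ.exists_mul_baseChange_apply_eq hLV.1 hLV.2 hL.1 hL.2 uV hkerV huV u hker hu
  obtain ⟨k, hk⟩ :=
    ψ.exists_algebraMap_eq_of_baseChange_apply_eq hLV.1 hLV.2 hL.1 hL.2 uV hkerV huV u hker hu happ
  have hkC : (k : ℂ) = α := by rw [← hk, eq_ratCast]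
  have hk0 : k ≠ 0 := by
    rintro rfl
    exact hα0 (by rw [← hkC, Rat.cast_zero])
  have hkle : ∀ z ∈ LV.lattice, (k : ℂ) * z ∈ L.lattice := fun z hz ↦ by rw [hkC]; exact hαΛ z hz
  -- strong induction on the index of a rational inclusion `cΛ_V ⊆ Λ`
  suffices key : ∀ (N : ℕ) (c : ℚ) (hc : c ≠ 0), (∀ z ∈ LV.lattice, (c : ℂ) * z ∈ L.lattice) →
      (LV.mulLeft (c : ℂ) (by exact_mod_cast hc)).lattice.toAddSubgroup.relIndex
        L.lattice.toAddSubgroup = N →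
      ∃ c' : ℚ, c' ≠ 0 ∧ (∀ z ∈ LV.lattice, (c' : ℂ) * z ∈ L.lattice) ∧
        ∃ d : ℕ, ¬ 3 ∣ d ∧ ∀ y ∈ L.lattice, ∃ x ∈ LV.lattice, (d : ℂ) * y = c' * x from
    key _ k hk0 hkle rfl
  intro N
  induction N using Nat.strong_induction_on with
  | _ N ih => ?_
  intro c hc hcle hN
  have hcC : (c : ℂ) ≠ 0 := by exact_mod_cast hc
  have hle : (LV.mulLeft (c : ℂ) hcC).lattice ≤ L.lattice :=
    mulLeft_lattice_le_of_forall_mul_mem hcC hcle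
  have hN0 : N ≠ 0 := hN ▸ relIndex_mulLeft_ne_zero hcC hle
  by_cases h3 : 3 ∣ N
  · -- the `ℚ`-isogeny `φ : V → W` of the inclusion, `z ↦ cz` on algebraic points, of degree `N`
    obtain ⟨φ, hdesc, hdeg⟩ := exists_isogeny_apply_eq_degree_eq_of_forall_mul_mem_lattice hLV.1
      hLV.2 hL.1 hL.2 uV hkerV hsurjV huV u hker hu j hc hcle
    have hdegN : φ.degree = N := by rw [hdeg, ← relIndex_mulLeft_eq_relIndex_comap hcC, hN]
    -- Cauchy: a kernel point of order `3`
    haveI : Fact (Nat.Prime 3) := ⟨Nat.prime_three⟩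
    obtain ⟨P, hP⟩ := exists_prime_addOrderOf_dvd_card' (G := φ.toAddMonoidHom.ker) 3
      (by rw [show Nat.card φ.toAddMonoidHom.ker = φ.degree from rfl, hdegN]; exact h3)
    have hP3 : (3 : ℕ) • (P : V.geomPoints) = 0 := by
      have h := addOrderOf_nsmul_eq_zero P
      rw [hP] at h
      exact_mod_cast congrArg Subtype.val h
    have hPne : (P : V.geomPoints) ≠ 0 := by
      intro h0
      have hP0 : P = 0 := Subtype.ext h0
      rw [hP0, addOrderOf_zero] at hP
      exact absurd hP (by norm_num)
    -- the `Γ_ℚ`-stable subgroup `H = ker φ ∩ V[3]` of `V[3]`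
    set H : AddSubgroup (geomTorsion V 3) := φ.toAddMonoidHom.ker.addSubgroupOf (geomTorsion V 3)
      with hH
    have hHst : ∀ σ : Field.absoluteGaloisGroup ℚ, ∀ T ∈ H, σ • T ∈ H := by
      intro σ T hT
      rw [hH, AddSubgroup.mem_addSubgroupOf, AddMonoidHom.mem_ker, Isogeny.coe_toAddMonoidHom] at hT ⊢
      rw [AddSubgroup.torsionBy.coe_smul, φ.map_smul, hT, smul_zero]
    rcases hirr H hHst with hbot | htop
    · -- `H = ⊥` contradicts `P ∈ H`
      exfalso
      have hmem : (⟨(P : V.geomPoints), AddSubgroup.torsionBy.nsmul_iff.mpr hP3⟩ : geomTorsion V 3) ∈ H := by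
        rw [hH, AddSubgroup.mem_addSubgroupOf]
        exact P.2
      rw [hbot, AddSubgroup.mem_bot] at hmem
      exact hPne (congrArg Subtype.val hmem)
    · -- `H = ⊤`: `φ` kills every `3`-torsion point, so `cΛ_V ⊆ 3Λ`
      have hc3 : ∀ z ∈ LV.lattice, ((c / 3 : ℚ) : ℂ) * z ∈ L.lattice := by
        intro l hl
        have h3z : (3 : ℕ) • uV (l / 3) = 0 := by
          rw [← map_nsmul, nsmul_eq_mul, Nat.cast_ofNat, mul_div_cancel₀ l three_ne_zero]
          exact (huV0 l).mpr hl
        obtain ⟨m, hm⟩ := mem_range_map_of_nsmul_eq_zero (W := V) j (by norm_num) _ h3z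
        have hm3 : (3 : ℕ) • m = 0 := by
          apply hjinj
          rw [map_nsmul, map_zero, hm, h3z]
        have hmH : (⟨m, AddSubgroup.torsionBy.nsmul_iff.mpr hm3⟩ : geomTorsion V 3) ∈ H := by
          rw [htop]; exact AddSubgroup.mem_top _
        rw [hH, AddSubgroup.mem_addSubgroupOf, AddMonoidHom.mem_ker, Isogeny.coe_toAddMonoidHom] at hmH
        have h := hdesc m (l / 3) hm
        have h0 : Affine.Point.map (W' := W) j (φ m) = 0 := by
          rw [show φ m = 0 from hmH]
          exact map_zero (Affine.Point.map (W' := W) j)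
        rw [h0] at h
        have h' := (hu0 _).mp h.symm
        have e : ((c / 3 : ℚ) : ℂ) * l = (c : ℂ) * (l / 3) := by push_cast; ring
        rw [e]
        exact h'
      -- the inclusion `(c/3)Λ_V ⊆ Λ` has smaller index
      have hc3ne : (c / 3 : ℚ) ≠ 0 := div_ne_zero hc (by norm_num)
      have hc3C : ((c / 3 : ℚ) : ℂ) ≠ 0 := by exact_mod_cast hc3ne
      have hle3 : (LV.mulLeft _ hc3C).lattice ≤ L.lattice := mulLeft_lattice_le_of_forall_mul_mem hc3C hc3
      set N' : ℕ := (LV.mulLeft _ hc3C).lattice.toAddSubgroup.relIndex L.lattice.toAddSubgroup with hN'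
      have hN'0 : N' ≠ 0 := relIndex_mulLeft_ne_zero hc3C hle3
      have hcc : (LV.mulLeft (c : ℂ) hcC).lattice ≤ (LV.mulLeft _ hc3C).lattice := by
        intro x hx
        rw [mem_mulLeft_lattice] at hx ⊢
        have e : ((c / 3 : ℚ) : ℂ)⁻¹ * x = (3 : ℤ) • ((c : ℂ)⁻¹ * x) := by
          rw [zsmul_eq_mul]
          push_cast
          field_simp
        rw [e]
        exact LV.lattice.smul_mem 3 hx
      have hne : ¬ (LV.mulLeft _ hc3C).lattice ≤ (LV.mulLeft (c : ℂ) hcC).lattice := by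
        intro h
        have hω : ((c / 3 : ℚ) : ℂ) * LV.ω₁ ∈ (LV.mulLeft _ hc3C).lattice :=
          mul_mem_mulLeft_lattice.mpr LV.ω₁_mem_lattice
        have h' := mem_mulLeft_lattice.mp (h hω)
        have e : (c : ℂ)⁻¹ * (((c / 3 : ℚ) : ℂ) * LV.ω₁) =
            ((1 / 3 : ℚ) : ℂ) * LV.ω₁ + ((0 : ℚ) : ℂ) * LV.ω₂ := by
          push_cast
          field_simp
          ring
        rw [e] at h'
        have hden := (mul_ω₁_add_mul_ω₂_mem_lattice.mp h').1
        norm_num at hden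
      have hmul : (LV.mulLeft (c : ℂ) hcC).lattice.toAddSubgroup.relIndex
          (LV.mulLeft _ hc3C).lattice.toAddSubgroup * N' = N := by
        rw [hN', ← hN]
        exact AddSubgroup.relIndex_mul_relIndex _ _ _ hcc hle3
      have hr1 : (LV.mulLeft (c : ℂ) hcC).lattice.toAddSubgroup.relIndex
          (LV.mulLeft _ hc3C).lattice.toAddSubgroup ≠ 1 := by
        rw [Ne, AddSubgroup.relIndex_eq_one]
        exact hne
      have hr0 : (LV.mulLeft (c : ℂ) hcC).lattice.toAddSubgroup.relIndex
          (LV.mulLeft _ hc3C).lattice.toAddSubgroup ≠ 0 := fun h0 ↦ hN0 (by rw [← hmul, h0, zero_mul])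
      have hlt : N' < N := by
        calc N' = 1 * N' := (one_mul _).symm
          _ < (LV.mulLeft (c : ℂ) hcC).lattice.toAddSubgroup.relIndex
              (LV.mulLeft _ hc3C).lattice.toAddSubgroup * N' :=
            Nat.mul_lt_mul_of_pos_right (by omega) (Nat.pos_of_ne_zero hN'0)
          _ = N := hmul
      exact ih N' hlt (c / 3) hc3ne hc3 hN'.symm
  · -- `3 ∤ N`: `d = N` kills the quotient `Λ / cΛ_V`
    refine ⟨c, hc, hcle, N, h3, fun y hy ↦ ?_⟩
    have hmem : N • y ∈ (LV.mulLeft (c : ℂ) hcC).lattice := by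
      have h := AddSubgroup.nsmul_index_mem
        ((LV.mulLeft (c : ℂ) hcC).lattice.toAddSubgroup.addSubgroupOf L.lattice.toAddSubgroup)
        (⟨y, hy⟩ : L.lattice.toAddSubgroup)
      rw [AddSubgroup.mem_addSubgroupOf] at h
      rw [← hN]
      exact h
    refine ⟨(c : ℂ)⁻¹ * (N • y), mem_mulLeft_lattice.mp hmem, ?_⟩
    rw [← mul_assoc, mul_inv_cancel₀ hcC, one_mul, nsmul_eq_mul]

/-! ### 3. The statement of `isogenyScalar_threeFree_of_irreducible` -/

/-- **Analytic isogeny scalar with `3`-free degree inside an isogeny class with `E[3]` irreducible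
(PROVED).** For elliptic `V, W₁, W₂ / ℚ` with `V ~ W₁`, `V ~ W₂` (`ℚ`-isogenous), `V[3]`
irreducible, and period pairs `L₁`, `L₂` of `W₁`, `W₂` (`IsNeronLatticeOf`), there are `α ∈ ℂ` and
`d ∈ ℕ`, `3 ∤ d`, with `α·L₂.lattice ⊆ L₁.lattice` and `d·L₁.lattice ⊆ α·L₂.lattice`. This is
VERBATIM the body of the named fact `isogenyScalar_threeFree_of_irreducible`
(`IsogenyAnalyticScalarThreeFree.lean`). [cite: SilvermanAEC2009, VI.4.1 (b), III.4.12 and III.6.2] [cite: Cremona1997, §3.8] -/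
theorem exists_isogenyScalar_threeFree_of_irreducible (V W₁ W₂ : WeierstrassCurve ℚ) [V.IsElliptic]
    [W₁.IsElliptic] [W₂.IsElliptic] (L₁ L₂ : PeriodPair)
    (hL₁ : IsNeronLatticeOf (W₁.baseChange ℂ) L₁) (hL₂ : IsNeronLatticeOf (W₂.baseChange ℂ) L₂)
    (hirr : V.HasIrreducibleModPGaloisRep 3) (h₁ : V.IsIsogenous W₁) (h₂ : V.IsIsogenous W₂) :
    ∃ (α : ℂ) (d : ℕ), ¬ 3 ∣ d ∧ (∀ x ∈ L₂.lattice, α * x ∈ L₁.lattice) ∧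
      (∀ y ∈ L₁.lattice, ∃ x ∈ L₂.lattice, (d : ℂ) * y = α * x) := by
  obtain ⟨ψ₁⟩ := h₁
  obtain ⟨ψ₂⟩ := h₂
  haveI : (V.baseChange ℂ).IsElliptic := by
    rw [WeierstrassCurve.baseChange]; infer_instance
  obtain ⟨LV, hLV⟩ := exists_isNeronLatticeOf_holds (V.baseChange ℂ)
  obtain ⟨c₁, hc₁, hc₁le, d₁, hd₁, hd₁sat⟩ :=
    exists_rat_mul_mem_lattice_threeFree_of_irreducible ψ₁ hLV hL₁ hirr
  obtain ⟨c₂, hc₂, hc₂le, d₂, hd₂, hd₂sat⟩ :=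
    exists_rat_mul_mem_lattice_threeFree_of_irreducible ψ₂ hLV hL₂ hirr
  have hc₂C : (c₂ : ℂ) ≠ 0 := by exact_mod_cast hc₂
  refine ⟨(c₁ : ℂ) * d₂ / c₂, d₁ * d₂, ?_, ?_, ?_⟩
  · intro h
    rcases (Nat.Prime.dvd_mul Nat.prime_three).mp h with h | h
    · exact hd₁ h
    · exact hd₂ h
  · intro x hx
    obtain ⟨x', hx', hx'eq⟩ := hd₂sat x hx
    have e : (c₁ : ℂ) * d₂ / c₂ * x = c₁ * x' := by
      rw [show (c₁ : ℂ) * d₂ / c₂ * x = (c₁ : ℂ) / c₂ * ((d₂ : ℂ) * x) by ring, hx'eq]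
      field_simp
    rw [e]
    exact hc₁le x' hx'
  · intro y hy
    obtain ⟨x', hx', hx'eq⟩ := hd₁sat y hy
    refine ⟨(c₂ : ℂ) * x', hc₂le x' hx', ?_⟩
    rw [Nat.cast_mul, show ((d₁ : ℂ) * d₂) * y = (d₂ : ℂ) * ((d₁ : ℂ) * y) by ring, hx'eq]
    field_simp

end Literature.NumberTheory.EllipticCurves

end
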